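import Mathlib
import HarnessLib
import Summits.HubbardSuperconductivity.HubbardSuperconductivity.Theorems.KLProgrammeKLRegimeEngineCutoffSrcNormsWtAt
import Summits.HubbardSuperconductivity.HubbardSuperconductivity.Theorems.KLProgrammeKLRegimeEngineCutoffKernelNormsWtAtFamily

/-!
# KL programme — K3 VL child (stmt-HubbardSuperconductivity-23356), atom HUV (`stub_vl_srcUV`, levels `j ≤ 1`): the weighted profile of `𝒱[K]_Λ` read by an
# ARBITRARY doubled analysis on the level-`J` doubled labels `T : SrcLabel L M J → fields`, at rate `j` — the family twin of `…EngineCutoffSrcNormsWtAt`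

Cell gate-hubbard-kl, seat p3 (g20).  `…EngineCutoffSrcNormsWtAt` (p671194 / p680082) is typed on `SrcLabel L M 0` with the scale-`0` tree weight; atom HUV at
level `j = 1` reads `𝒱_2[K] = 𝒱[K]_{Λ₂}` through `klSrcAnalysisAtW … 1` on `SrcLabel L M 1` with the rate-`1` weight `klScaleWt … 1`.  As in the weights-side
family file `…EngineCutoffKernelNormsWtAtFamily` (p668311), the step theorems never look at `J` or `j`: the positions are `srcLegPos L M (4M)` on any
`SrcLabel L M J`, and `klScaleWt … j ≤ klScaleWt … 0 ≤ gridLabelWt` (`klScaleWt_le_of_le`).  This file restates the three doors with `(J, j)` free: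

* `srcPinnedSum_cutoffFam_le_of_wgridStep` (degrees `2p ≥ 4`, bi-graded), `srcPinnedSum_cutoffFam_le_of_wgridStep_full` (every `m ≥ 1`),
  `srcPinnedSum_klEffectiveAction_fam_le_of_wgridStep` (cutoff `Λ_n`, every degree, `N`-threshold form; odd degrees by
  `kernel_map_hubbardEffectiveActionCT_eq_zero_of_odd`).

Proofs only; no definition; nothing asserts HUV, any stub, VL, K3 or superconductivity.
[cite: BenfattoGiulianiMastropietro2006, §2.7 (2.77)–(2.81), §3 (3.2)–(3.8)]
-/

noncomputable section

namespace Summit.HubbardSuperconductivity.HubbardSuperconductivity.Theorems.EngineV8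

set_option linter.dupNamespace false -- summit = problem name (single-conjunct summit), D-0017

open Real Finset Literature.MathematicalPhysics.QuantumLattice Literature.Probability.LatticeModels
open Literature.Probability.LatticeModels.BattleFederbush
open Literature.MathematicalPhysics.QuantumLattice.GrassmannAlgebra
open Summit.HubbardSuperconductivity.HubbardSuperconductivity.Theorems.KLRegimeSplit
open Summit.HubbardSuperconductivity.HubbardSuperconductivity.Theorems.DispersionFlow
open Summit.HubbardSuperconductivity.HubbardSuperconductivity.Theorems.KLProgrammeLegKernels
open Summit.HubbardSuperconductivity.HubbardSuperconductivity.Theorems.TwoVolumeSource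

variable {L M : ℕ} [NeZero L]

/-! ## §3 Degrees `2p ≥ 4`: the bi-graded weighted step read through `E₀S` -/

/-- **(E1-W)₀ in degrees `2p ≥ 4` from ONE decay-weighted bi-graded determinant-bounded step** (modulo the three weighted sizes).
`S = hubbardGridSub … (4M)`, `C₀ = C^K_{>e₀}`, `E₀ = sectorAnalysisMatrix β (klAnisoFamily … klE0 0)`, `wt = gridLabelWt L (4M) β`:
if `SᵀC₀S` is replica-Gram-bounded (`κ`) with `wt`-pair-weighted row / column sums `≤ α_w`, `θ_w = e·α_w·‖Ṽ‖_{h,wt}/κ² < 1` for the weighted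
profile of the grid vertex and a weight `ρ > 0`, and `E₀S` has `wt`-pair-weighted row / column sums `≤ cr_w / cc_w`, then for every `p ≥ 2`,
pinned leg `q` and field index `w`:
`klWtPinnedSum … K 0 (2p) q w ≤ ε_x^{2p-1}·cr_w·cc_w^{2p-1}·(ρ^{-2p}·e f₂·(eα_w f₂/κ²)^{p-2}/(1-θ_w)^p)`, `f₂ = (e²(κ+ρ))⁴·|U||β|/(4M)`. -/
theorem srcPinnedSum_cutoffFam_le_of_wgridStep [NeZero M] {β : ℝ} (hβ : 0 < β) (U μ : ℝ) (K : TrigPolyC4v) (Λ : ℝ) (J j : ℕ)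
    (T : Matrix (SrcLabel L M J) (HubbardFieldIdx L M) ℂ)
    {κ : ℝ} (hκ : 0 < κ)
    (hGB : IsGramBoundedR ((hubbardGridSub L M β (2 * (2 * M))).transpose * hubbardCovAboveCT L M β μ 0 K Λ *
      hubbardGridSub L M β (2 * (2 * M))) κ)
    {αw : ℝ} (hαw : 0 < αw)
    (hrow : ∀ X, ∑ Y, ‖((hubbardGridSub L M β (2 * (2 * M))).transpose * hubbardCovAboveCT L M β μ 0 K Λ *
      hubbardGridSub L M β (2 * (2 * M))) X Y‖ * gridLabelWt L (2 * (2 * M)) β {gridLegPos X, gridLegPos Y} ≤ αw)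
    (hcol : ∀ Y, ∑ X, ‖((hubbardGridSub L M β (2 * (2 * M))).transpose * hubbardCovAboveCT L M β μ 0 K Λ *
      hubbardGridSub L M β (2 * (2 * M))) X Y‖ * gridLabelWt L (2 * (2 * M)) β {gridLegPos X, gridLegPos Y} ≤ αw)
    {ρ : ℝ} (hρ : 0 < ρ)
    (hθ : Real.exp 1 * αw * normV (GridLeg (GridPoint L (2 * (2 * M)))) κ ρ
      (fun m' : ℕ => if m' = 1 then |β| / (2 * (2 * M) : ℕ) * ∑ z : TorusSite 2 L, ‖framePosKernel L K z‖ * (1 + torusSiteDist z 0)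
        else if m' = 2 then |U| * |β| / (2 * (2 * M) : ℕ) else 0) / κ ^ 2 < 1)
    {crw ccw : ℝ} (hccw0 : 0 ≤ ccw)
    (hrow' : ∀ X'' : SrcLabel L M J, ∑ X' : GridLeg (GridPoint L (2 * (2 * M))),
      ‖(T * hubbardGridSub L M β (2 * (2 * M))) X'' X'‖ *
        gridLabelWt L (2 * (2 * M)) β {srcLegPos L M (2 * (2 * M)) X'', gridLegPos X'} ≤ crw)
    (hcol' : ∀ X' : GridLeg (GridPoint L (2 * (2 * M))), ∑ X'' : SrcLabel L M J,
      ‖(T * hubbardGridSub L M β (2 * (2 * M))) X'' X'‖ *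
        gridLabelWt L (2 * (2 * M)) β {srcLegPos L M (2 * (2 * M)) X'', gridLegPos X'} ≤ ccw)
    {p : ℕ} (hp : 2 ≤ p) (q : Fin (2 * p)) (w : SrcLabel L M J) :
    imagTimeWeight β M ^ (2 * p - 1) *
      ∑ X ∈ univ.filter (fun X : Fin (2 * p) → SrcLabel L M J => X q = w),
        klScaleWt L M β j ((univ.image X).image (srcLegPos L M (2 * (2 * M)))) *
          ‖kernel ℂ (ExteriorAlgebra.map (Matrix.toLin' T) (hubbardEffectiveActionCT L M β U μ 0 K Λ)) (2 * p) X‖ ≤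
      imagTimeWeight β M ^ (2 * p - 1) *
        (crw * ccw ^ (2 * p - 1) *
          (ρ⁻¹ ^ (2 * p) * (Real.exp 1 * ((Real.exp 2 * (κ + ρ)) ^ (2 * 2) * (|U| * |β| / (2 * (2 * M) : ℕ)))) *
            (Real.exp 1 * αw * ((Real.exp 2 * (κ + ρ)) ^ (2 * 2) * (|U| * |β| / (2 * (2 * M) : ℕ))) / κ ^ 2) ^ (p - 2) /
              (1 - Real.exp 1 * αw * normV (GridLeg (GridPoint L (2 * (2 * M)))) κ ρ
                (fun m' : ℕ => if m' = 1 then |β| / (2 * (2 * M) : ℕ) * ∑ z : TorusSite 2 L, ‖framePosKernel L K z‖ * (1 + torusSiteDist z 0)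
                  else if m' = 2 then |U| * |β| / (2 * (2 * M) : ℕ) else 0) / κ ^ 2) ^ p)) := by
  -- notation
  set Ng : ℕ := 2 * (2 * M) with hNg
  haveI : NeZero Ng := ⟨by rw [hNg]; have := NeZero.ne M; omega⟩
  set S := hubbardGridSub L M β Ng with hS
  set C₀ := hubbardCovAboveCT L M β μ 0 K Λ with hC₀
  set E₀ := T with hE₀
  set Vt := hubbardGridInteraction L Ng β U + hubbardGridCounterQuadratic L Ng β K with hVt
  set wt := gridLabelWt L Ng β with hwt
  set Nw : ℕ → ℝ := fun m' : ℕ => if m' = 1 then |β| / Ng * ∑ z : TorusSite 2 L, ‖framePosKernel L K z‖ * (1 + torusSiteDist z 0)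
    else if m' = 2 then |U| * |β| / Ng else 0 with hNw
  have hwtree : IsTreeWeight wt := isTreeWeight_gridLabelWt L Ng hβ.le
  have hfS : LinearMap.toMatrix' (Matrix.toLin' S) = S := LinearMap.toMatrix'_toLin' S
  have hgE : LinearMap.toMatrix' (Matrix.toLin' E₀) = E₀ := LinearMap.toMatrix'_toLin' E₀
  have hVt_even : Vt ∈ evenPart ℂ (GridLeg (GridPoint L Ng)) :=
    add_mem (hubbardGridInteraction_mem_evenPart β U) (hubbardGridCounterQuadratic_mem_evenPart β K)
  have hVt0 : constPart ℂ Vt = 0 := by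
    rw [hVt, map_add, constPart_hubbardGridInteraction, constPart_hubbardGridCounterQuadratic, add_zero]
  have hNw2 : ∀ m', 2 < m' → Nw m' = 0 := fun m' hm' => by
    rw [hNw]; dsimp only; rw [if_neg (by omega), if_neg (by omega)]
  -- (1) the weighted bi-graded step, output degree `2p`, leg `q` pinned at `w`
  have hstep := (sum_wt_norm_kernel_map_effAction_le_biquartic_of_gramBounded hwtree gridLegPos (srcLegPos L M Ng) C₀ (Matrix.toLin' S)
    (Matrix.toLin' E₀) Vt hVt_even hVt0 Nw (scaleZeroPinnedW_nonneg β U K)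
    (fun m' j w => sum_norm_kernel_gridVertex_mul_wt_le β U hβ.le K m' j w) hNw2 hκ (by rw [hfS]; exact hGB) hαw
    (by rw [hfS]; exact hrow) (by rw [hfS]; exact hcol) hρ hθ hccw0
    (fun X'' => by rw [hfS, hgE]; exact hrow' X'') (fun X' => by rw [hfS, hgE]; exact hcol' X') hp q w).2
  -- (2) the pinned sum in `klWtPinnedSum` currency: the action is the analysed step, the weight is dominated by `wt`
  rw [hubbardEffectiveActionCT_eq_effAction_gridSub hβ.ne' U μ K Λ]
  refine mul_le_mul_of_nonneg_left ?_ (pow_nonneg (imagTimeWeight_nonneg hβ.le M) _)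
  refine le_trans (sum_le_sum fun X _ => ?_) hstep
  exact mul_le_mul_of_nonneg_right ((klScaleWt_le_of_le β (Nat.zero_le j) _).trans (klScaleWt_zero_le_gridLabelWt β _)) (norm_nonneg _)

/-! ## §4 Every positive degree: the full weighted step read through `E₀S` -/

/-- **(E1-W)₀ in every degree `m ≥ 1` from the FULL decay-weighted determinant-bounded step** (same three weighted sizes; used at
`m = 2`, where the kernel of `𝒱⁽⁰⁾` contains the counterterm and the tadpole):
`klWtPinnedSum … K 0 m q w ≤ ε_x^{m-1}·cr_w·cc_w^{m-1}·(ρ^{-m}·e‖Ṽ‖_{h,wt}/(1-θ_w))`, `‖Ṽ‖_{h,wt} = normV κ ρ N_w`. -/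
theorem srcPinnedSum_cutoffFam_le_of_wgridStep_full [NeZero M] {β : ℝ} (hβ : 0 < β) (U μ : ℝ) (K : TrigPolyC4v) (Λ : ℝ) (J j : ℕ)
    (T : Matrix (SrcLabel L M J) (HubbardFieldIdx L M) ℂ)
    {κ : ℝ} (hκ : 0 < κ)
    (hGB : IsGramBoundedR ((hubbardGridSub L M β (2 * (2 * M))).transpose * hubbardCovAboveCT L M β μ 0 K Λ *
      hubbardGridSub L M β (2 * (2 * M))) κ)
    {αw : ℝ} (hαw : 0 < αw)
    (hrow : ∀ X, ∑ Y, ‖((hubbardGridSub L M β (2 * (2 * M))).transpose * hubbardCovAboveCT L M β μ 0 K Λ *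
      hubbardGridSub L M β (2 * (2 * M))) X Y‖ * gridLabelWt L (2 * (2 * M)) β {gridLegPos X, gridLegPos Y} ≤ αw)
    (hcol : ∀ Y, ∑ X, ‖((hubbardGridSub L M β (2 * (2 * M))).transpose * hubbardCovAboveCT L M β μ 0 K Λ *
      hubbardGridSub L M β (2 * (2 * M))) X Y‖ * gridLabelWt L (2 * (2 * M)) β {gridLegPos X, gridLegPos Y} ≤ αw)
    {ρ : ℝ} (hρ : 0 < ρ)
    (hθ : Real.exp 1 * αw * normV (GridLeg (GridPoint L (2 * (2 * M)))) κ ρ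
      (fun m' : ℕ => if m' = 1 then |β| / (2 * (2 * M) : ℕ) * ∑ z : TorusSite 2 L, ‖framePosKernel L K z‖ * (1 + torusSiteDist z 0)
        else if m' = 2 then |U| * |β| / (2 * (2 * M) : ℕ) else 0) / κ ^ 2 < 1)
    {crw ccw : ℝ} (hccw0 : 0 ≤ ccw)
    (hrow' : ∀ X'' : SrcLabel L M J, ∑ X' : GridLeg (GridPoint L (2 * (2 * M))),
      ‖(T * hubbardGridSub L M β (2 * (2 * M))) X'' X'‖ *
        gridLabelWt L (2 * (2 * M)) β {srcLegPos L M (2 * (2 * M)) X'', gridLegPos X'} ≤ crw)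
    (hcol' : ∀ X' : GridLeg (GridPoint L (2 * (2 * M))), ∑ X'' : SrcLabel L M J,
      ‖(T * hubbardGridSub L M β (2 * (2 * M))) X'' X'‖ *
        gridLabelWt L (2 * (2 * M)) β {srcLegPos L M (2 * (2 * M)) X'', gridLegPos X'} ≤ ccw)
    {m : ℕ} (hm : 0 < m) (q : Fin m) (w : SrcLabel L M J) :
    imagTimeWeight β M ^ (m - 1) *
      ∑ X ∈ univ.filter (fun X : Fin m → SrcLabel L M J => X q = w),
        klScaleWt L M β j ((univ.image X).image (srcLegPos L M (2 * (2 * M)))) *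
          ‖kernel ℂ (ExteriorAlgebra.map (Matrix.toLin' T) (hubbardEffectiveActionCT L M β U μ 0 K Λ)) m X‖ ≤
      imagTimeWeight β M ^ (m - 1) *
        (crw * ccw ^ (m - 1) *
          (ρ⁻¹ ^ m * (Real.exp 1 * normV (GridLeg (GridPoint L (2 * (2 * M)))) κ ρ
              (fun m' : ℕ => if m' = 1 then |β| / (2 * (2 * M) : ℕ) * ∑ z : TorusSite 2 L, ‖framePosKernel L K z‖ * (1 + torusSiteDist z 0)
                else if m' = 2 then |U| * |β| / (2 * (2 * M) : ℕ) else 0)) /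
            (1 - Real.exp 1 * αw * normV (GridLeg (GridPoint L (2 * (2 * M)))) κ ρ
              (fun m' : ℕ => if m' = 1 then |β| / (2 * (2 * M) : ℕ) * ∑ z : TorusSite 2 L, ‖framePosKernel L K z‖ * (1 + torusSiteDist z 0)
                else if m' = 2 then |U| * |β| / (2 * (2 * M) : ℕ) else 0) / κ ^ 2))) := by
  -- notation
  set Ng : ℕ := 2 * (2 * M) with hNg
  haveI : NeZero Ng := ⟨by rw [hNg]; have := NeZero.ne M; omega⟩
  set S := hubbardGridSub L M β Ng with hS
  set C₀ := hubbardCovAboveCT L M β μ 0 K Λ with hC₀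
  set C' := S.transpose * C₀ * S with hC'
  set E₀ := T with hE₀
  set Vt := hubbardGridInteraction L Ng β U + hubbardGridCounterQuadratic L Ng β K with hVt
  set wt := gridLabelWt L Ng β with hwt
  set Nw : ℕ → ℝ := fun m' : ℕ => if m' = 1 then |β| / Ng * ∑ z : TorusSite 2 L, ‖framePosKernel L K z‖ * (1 + torusSiteDist z 0)
    else if m' = 2 then |U| * |β| / Ng else 0 with hNw
  have hwtree : IsTreeWeight wt := isTreeWeight_gridLabelWt L Ng hβ.le
  -- the weight pulled back to the grid legs
  have hwt' : IsTreeWeight (fun T : Finset (GridLeg (GridPoint L Ng)) => wt (T.image gridLegPos)) := hwtree.comap gridLegPos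
  have hpair : ∀ X Y : GridLeg (GridPoint L Ng), (fun T : Finset (GridLeg (GridPoint L Ng)) => wt (T.image gridLegPos)) {X, Y} =
      wt {gridLegPos X, gridLegPos Y} := fun X Y => by simp only [image_insert, image_singleton]
  have hfS : LinearMap.toMatrix' (Matrix.toLin' S) = S := LinearMap.toMatrix'_toLin' S
  have hgE : LinearMap.toMatrix' (Matrix.toLin' E₀) = E₀ := LinearMap.toMatrix'_toLin' E₀
  have hVt_even : Vt ∈ evenPart ℂ (GridLeg (GridPoint L Ng)) :=
    add_mem (hubbardGridInteraction_mem_evenPart β U) (hubbardGridCounterQuadratic_mem_evenPart β K)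
  have hVt0 : constPart ℂ Vt = 0 := by
    rw [hVt, map_add, constPart_hubbardGridInteraction, constPart_hubbardGridCounterQuadratic, add_zero]
  -- (1) the full weighted step on the grid with covariance `C' = SᵀC₀S`
  obtain ⟨-, hfull⟩ := sum_wt_norm_kernel_effAction_le_of_gramBounded C' hwt' hκ hGB Vt hVt_even hVt0 Nw (scaleZeroPinnedW_nonneg β U K)
    (fun m' j w => sum_norm_kernel_gridVertex_mul_wt_le β U hβ.le K m' j w) hαw
    (fun X => by simp only [hpair]; exact hrow X) (fun Y => by simp only [hpair]; exact hcol Y) hρ hθ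
  have hθle : 0 ≤ 1 - Real.exp 1 * αw * normV (GridLeg (GridPoint L Ng)) κ ρ Nw / κ ^ 2 := sub_nonneg.2 hθ.le
  have hB0 : 0 ≤ ρ⁻¹ ^ m * (Real.exp 1 * normV (GridLeg (GridPoint L Ng)) κ ρ Nw) /
      (1 - Real.exp 1 * αw * normV (GridLeg (GridPoint L Ng)) κ ρ Nw / κ ^ 2) :=
    div_nonneg (mul_nonneg (pow_nonneg (inv_nonneg.2 hρ.le) _)
      (mul_nonneg (Real.exp_pos 1).le (normV_nonneg hκ.le hρ.le (scaleZeroPinnedW_nonneg β U K)))) hθle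
  have hfull' : ∀ (q' : Fin m) (x : GridLeg (GridPoint L Ng)),
      ∑ X ∈ univ.filter (fun X : Fin m → GridLeg (GridPoint L Ng) => X q' = x),
        ‖kernel ℂ (effAction ℂ C' Vt) m X‖ * wt ((univ.image X).image gridLegPos) ≤
          ρ⁻¹ ^ m * (Real.exp 1 * normV (GridLeg (GridPoint L Ng)) κ ρ Nw) /
            (1 - Real.exp 1 * αw * normV (GridLeg (GridPoint L Ng)) κ ρ Nw / κ ^ 2) := by
    intro q' x
    exact (le_of_eq (sum_congr rfl fun X _ => mul_comm _ _)).trans (hfull hm q' x)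
  -- (2) read through `E₀S` by the weighted Young step
  have hyoung := sum_filter_wt_norm_kernel_map_le_of_pos hwtree gridLegPos (srcLegPos L M Ng)
    ((Matrix.toLin' E₀) ∘ₗ (Matrix.toLin' S)) hccw0
    (by intro X''; rw [LinearMap.toMatrix'_comp, hfS, hgE]; exact hrow' X'')
    (by intro X'; rw [LinearMap.toMatrix'_comp, hfS, hgE]; exact hcol' X') (effAction ℂ C' Vt) hm hB0 hfull' q w
  -- (3) the pinned sum in `klWtPinnedSum` currency
  rw [hubbardEffectiveActionCT_eq_effAction_gridSub hβ.ne' U μ K Λ]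
  refine mul_le_mul_of_nonneg_left ?_ (pow_nonneg (imagTimeWeight_nonneg hβ.le M) _)
  have hrepr : ExteriorAlgebra.map (Matrix.toLin' E₀) (effAction ℂ C₀ (ExteriorAlgebra.map (Matrix.toLin' S) Vt)) =
      ExteriorAlgebra.map ((Matrix.toLin' E₀) ∘ₗ (Matrix.toLin' S)) (effAction ℂ C' Vt) := by
    rw [effAction_map, hfS, map_map_eq_map_comp]
  rw [hrepr]
  refine le_trans (sum_le_sum fun X _ => ?_) hyoung
  exact mul_le_mul_of_nonneg_right ((klScaleWt_le_of_le β (Nat.zero_le j) _).trans (klScaleWt_zero_le_gridLabelWt β _)) (norm_nonneg _)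

/-! ## Every degree at the KL cutoffs (family form; `J`, `j` free) -/

/-- **THE DOUBLED DOOR AT THE KL CUTOFF `Λ_n = klScale klE0 n`, EVERY DEGREE** (`klEffectiveAction … K klE0 n = 𝒱[K]_{Λ_n}`; at `n = 1` this is the
level-`0` datum of atom HUV read by any doubled analysis `T`, e.g. `klSrcAnalysisAtW … 0`): for any degree budget `N` dominating the degree-`2` bound of
`srcPinnedSum_cutoff_le_of_wgridStep_full` and the bi-graded bounds of `srcPinnedSum_cutoff_le_of_wgridStep` (odd degrees vanish),
`∀ m q w, ε^{m-1}·Σ_{X ∋ (q ↦ w)} klScaleWt₀·‖kernel (T·𝒱[K]_{Λ_n}) m X‖ ≤ N m`. [cite: BenfattoGiulianiMastropietro2006, §2.7 (2.77)–(2.81)] -/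
theorem srcPinnedSum_klEffectiveAction_fam_le_of_wgridStep [NeZero M] {β : ℝ} (hβ : 0 < β) (U μ : ℝ) (K : TrigPolyC4v) (n J j : ℕ)
    (T : Matrix (SrcLabel L M J) (HubbardFieldIdx L M) ℂ)
    {κ : ℝ} (hκ : 0 < κ)
    (hGB : IsGramBoundedR ((hubbardGridSub L M β (2 * (2 * M))).transpose * hubbardCovAboveCT L M β μ 0 K (klScale klE0 n) *
      hubbardGridSub L M β (2 * (2 * M))) κ)
    {αw : ℝ} (hαw : 0 < αw)
    (hrow : ∀ X, ∑ Y, ‖((hubbardGridSub L M β (2 * (2 * M))).transpose * hubbardCovAboveCT L M β μ 0 K (klScale klE0 n) *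
      hubbardGridSub L M β (2 * (2 * M))) X Y‖ * gridLabelWt L (2 * (2 * M)) β {gridLegPos X, gridLegPos Y} ≤ αw)
    (hcol : ∀ Y, ∑ X, ‖((hubbardGridSub L M β (2 * (2 * M))).transpose * hubbardCovAboveCT L M β μ 0 K (klScale klE0 n) *
      hubbardGridSub L M β (2 * (2 * M))) X Y‖ * gridLabelWt L (2 * (2 * M)) β {gridLegPos X, gridLegPos Y} ≤ αw)
    {ρ : ℝ} (hρ : 0 < ρ)
    (hθ : Real.exp 1 * αw * normV (GridLeg (GridPoint L (2 * (2 * M)))) κ ρ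
      (fun m' : ℕ => if m' = 1 then |β| / (2 * (2 * M) : ℕ) * ∑ z : TorusSite 2 L, ‖framePosKernel L K z‖ * (1 + torusSiteDist z 0)
        else if m' = 2 then |U| * |β| / (2 * (2 * M) : ℕ) else 0) / κ ^ 2 < 1)
    {crw ccw : ℝ} (hccw0 : 0 ≤ ccw)
    (hrow' : ∀ X'' : SrcLabel L M J, ∑ X' : GridLeg (GridPoint L (2 * (2 * M))),
      ‖(T * hubbardGridSub L M β (2 * (2 * M))) X'' X'‖ *
        gridLabelWt L (2 * (2 * M)) β {srcLegPos L M (2 * (2 * M)) X'', gridLegPos X'} ≤ crw)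
    (hcol' : ∀ X' : GridLeg (GridPoint L (2 * (2 * M))), ∑ X'' : SrcLabel L M J,
      ‖(T * hubbardGridSub L M β (2 * (2 * M))) X'' X'‖ *
        gridLabelWt L (2 * (2 * M)) β {srcLegPos L M (2 * (2 * M)) X'', gridLegPos X'} ≤ ccw)
    (N : ℕ → ℝ) (hNodd : ∀ m, Odd m → 0 ≤ N m)
    (hN2 : imagTimeWeight β M ^ (2 - 1) *
        (crw * ccw ^ (2 - 1) *
          (ρ⁻¹ ^ 2 * (Real.exp 1 * normV (GridLeg (GridPoint L (2 * (2 * M)))) κ ρ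
              (fun m' : ℕ => if m' = 1 then |β| / (2 * (2 * M) : ℕ) * ∑ z : TorusSite 2 L, ‖framePosKernel L K z‖ * (1 + torusSiteDist z 0)
                else if m' = 2 then |U| * |β| / (2 * (2 * M) : ℕ) else 0)) /
            (1 - Real.exp 1 * αw * normV (GridLeg (GridPoint L (2 * (2 * M)))) κ ρ
              (fun m' : ℕ => if m' = 1 then |β| / (2 * (2 * M) : ℕ) * ∑ z : TorusSite 2 L, ‖framePosKernel L K z‖ * (1 + torusSiteDist z 0)
                else if m' = 2 then |U| * |β| / (2 * (2 * M) : ℕ) else 0) / κ ^ 2))) ≤ N 2)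
    (hNp : ∀ p, 2 ≤ p → imagTimeWeight β M ^ (2 * p - 1) *
        (crw * ccw ^ (2 * p - 1) *
          (ρ⁻¹ ^ (2 * p) * (Real.exp 1 * ((Real.exp 2 * (κ + ρ)) ^ (2 * 2) * (|U| * |β| / (2 * (2 * M) : ℕ)))) *
            (Real.exp 1 * αw * ((Real.exp 2 * (κ + ρ)) ^ (2 * 2) * (|U| * |β| / (2 * (2 * M) : ℕ))) / κ ^ 2) ^ (p - 2) /
              (1 - Real.exp 1 * αw * normV (GridLeg (GridPoint L (2 * (2 * M)))) κ ρ
                (fun m' : ℕ => if m' = 1 then |β| / (2 * (2 * M) : ℕ) * ∑ z : TorusSite 2 L, ‖framePosKernel L K z‖ * (1 + torusSiteDist z 0)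
                  else if m' = 2 then |U| * |β| / (2 * (2 * M) : ℕ) else 0) / κ ^ 2) ^ p)) ≤ N (2 * p)) :
    ∀ (m : ℕ) (q : Fin m) (w : SrcLabel L M J),
      imagTimeWeight β M ^ (m - 1) *
        ∑ X ∈ univ.filter (fun X : Fin m → SrcLabel L M J => X q = w),
          klScaleWt L M β j ((univ.image X).image (srcLegPos L M (2 * (2 * M)))) *
            ‖kernel ℂ (ExteriorAlgebra.map (Matrix.toLin' T) (klEffectiveAction L M β U μ K klE0 n)) m X‖ ≤ N m := by
  intro m q w
  rw [show klEffectiveAction L M β U μ K klE0 n = hubbardEffectiveActionCT L M β U μ 0 K (klScale klE0 n) from rfl]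
  rcases Nat.even_or_odd m with he | ho
  · obtain ⟨p, hp⟩ := he
    rcases Nat.lt_or_ge p 2 with hp2 | hp2
    · -- `m = 0` or `m = 2`
      interval_cases p
      · exact absurd q.2 (by omega)
      · subst hp
        exact (srcPinnedSum_cutoffFam_le_of_wgridStep_full hβ U μ K _ J j T hκ hGB hαw hrow hcol hρ hθ hccw0 hrow' hcol' (by norm_num) q w).trans hN2
    · have hm : m = 2 * p := by rw [hp]; ring
      subst hm
      exact (srcPinnedSum_cutoffFam_le_of_wgridStep hβ U μ K _ J j T hκ hGB hαw hrow hcol hρ hθ hccw0 hrow' hcol' hp2 q w).trans (hNp p hp2)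
  · have h0 : ∀ X : Fin m → SrcLabel L M J,
        kernel ℂ (ExteriorAlgebra.map (Matrix.toLin' T) (hubbardEffectiveActionCT L M β U μ 0 K (klScale klE0 n))) m X = 0 :=
      fun X => kernel_map_hubbardEffectiveActionCT_eq_zero_of_odd hβ.ne' U μ K _ T ho X
    simp only [h0, norm_zero, mul_zero, sum_const_zero, mul_zero]
    exact hNodd m ho

end Summit.HubbardSuperconductivity.HubbardSuperconductivity.Theorems.EngineV8

end
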